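import Literature.NumberTheory.LFunctions.SiegelWalfiszMoebiusProofs
import Mathlib.Analysis.SpecialFunctions.Pow.Asymptotics
import HarnessLib

/-!
# Möbius orthogonality of periodic and almost periodic sequences (Konieczny 2020, §2), proved

Topic `Literature/NumberTheory/LFunctions`. Everything in this file is PROVED; it is the first
brick of the proof of `Literature.NumberTheory.LFunctions.konieczny_semimultiplicative_moebius`
(J. Konieczny, *Möbius orthogonality for q-semimultiplicative sequences*, Monatsh. Math. 192
(2020), Theorem 1; arXiv:1808.06196), following the printed proof (§2, "Proof structure"):

* `Konieczny.moebius_residue_sum_le` — for a fixed modulus `Q ≥ 1`, uniformly in the residue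
  `a`, `∑_{n<N, n ≡ a (Q)} μ(n) = o(N)`.  In the paper this is the remark "periodic sequences are
  independently known to be orthogonal to `μ`" (prime number theorem in arithmetic progressions);
  here it is read off the PROVED Siegel–Walfisz bound
  `Literature.NumberTheory.LFunctions.SiegelWalfiszMoebius_holds` (Montgomery–Vaughan §11.3) with
  `A = 1`, i.e. for `Q ≤ log N`.
* `Konieczny.periodic_sum_mul_moebius_le` — `1`-bounded `Q`-periodic sequences are orthogonal to
  `μ`, uniformly in the sequence (only `Q` and the bound enter).
* `Konieczny.IsAlmostPeriodic` — Definition 2.2 of the paper (see the docstring for the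
  rendering) and `Konieczny.IsAlmostPeriodic.tendsto_moebius` — Lemma 2.3: almost periodic
  `1`-bounded sequences are orthogonal to `μ`.
* `Konieczny.IsAlmostPeriodic.mul_periodic` — the instance of Lemma 2.5 used in §8 (product of
  an almost periodic sequence with a `1`-bounded periodic one).

Conventions: `𝔼_{n<N}` of the paper is `(N : ℂ)⁻¹ * ∑ n ∈ Finset.range N`, `μ 0 = 0`.
-/

noncomputable section

open Filter Finset
open scoped Topology ArithmeticFunction.Moebius

namespace Literature.NumberTheory.LFunctions

namespace Konieczny

/-! ## Möbius in a fixed residue class -/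

/-- The Siegel–Walfisz bound specialised to `A = 1` and integer `x = N`, for the sums over
`{n ≤ N : n ≡ a (Q)}` written with `Finset.range (N+1)` and `n % Q`. [cite: MontgomeryVaughan2007, §11.3 Exercise 13(f) p. 384] -/
theorem moebius_residue_sum_le_exp :
    ∃ c : ℝ, 0 < c ∧ ∃ C : ℝ, ∀ Q : ℕ, 0 < Q → ∀ N : ℕ, (2 : ℝ) ≤ N → (Q : ℝ) ≤ Real.log N →
      ∀ a : ℕ, |∑ n ∈ (range (N + 1)).filter (fun n => n % Q = a % Q), (μ n : ℝ)| ≤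
        C * N * Real.exp (-c * Real.sqrt (Real.log N)) := by
  obtain ⟨c, hc, hall⟩ := SiegelWalfiszMoebius_holds
  obtain ⟨C, hC⟩ := hall 1 one_pos
  refine ⟨c, hc, C, fun Q hQ N hN hQN a => ?_⟩
  have h := hC (N : ℝ) hN Q hQ (by rwa [Real.rpow_one]) (a : ZMod Q)
  rw [Nat.floor_natCast] at h
  -- `∑_{n ∈ range (N+1)} F n = ∑_{n ∈ Icc 1 N} F n` when `F 0 = 0`
  have hIcc : ∀ F : ℕ → ℝ, F 0 = 0 → ∑ n ∈ range (N + 1), F n = ∑ n ∈ Icc 1 N, F n := by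
    intro F hF
    rw [Finset.range_eq_Ico, Finset.sum_eq_sum_Ico_succ_bot (by omega : 0 < N + 1), hF,
      zero_add, Finset.Ico_add_one_right_eq_Icc]
  convert h using 2
  rw [Finset.sum_filter, Finset.sum_filter, hIcc _ (by simp)]
  refine Finset.sum_congr rfl fun n _ => ?_
  simp only [ZMod.natCast_eq_natCast_iff']

/-- `exp(-c √(log N)) → 0` along the naturals (`c > 0`). [folklore] -/
theorem tendsto_exp_neg_sqrt_log {c : ℝ} (hc : 0 < c) :
    Tendsto (fun N : ℕ => Real.exp (-c * Real.sqrt (Real.log N))) atTop (𝓝 0) := by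
  refine Real.tendsto_exp_atBot.comp ?_
  have h1 : Tendsto (fun N : ℕ => Real.sqrt (Real.log N)) atTop atTop := by
    have hs : Tendsto Real.sqrt atTop atTop := by
      have := tendsto_rpow_atTop (show (0 : ℝ) < 1 / 2 by norm_num)
      refine this.congr fun x => ?_
      rw [Real.sqrt_eq_rpow]
    exact hs.comp (Real.tendsto_log_atTop.comp tendsto_natCast_atTop_atTop)
  have h2 := h1.const_mul_atTop hc
  have h3 : Tendsto (fun N : ℕ => -(c * Real.sqrt (Real.log N))) atTop atBot :=
    tendsto_neg_atTop_atBot.comp h2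
  refine h3.congr fun N => ?_
  ring

/-- **Möbius is `o(N)` in every residue class of a fixed modulus** (PNT in arithmetic
progressions, here from Siegel–Walfisz): for `Q ≥ 1` and `ε > 0` there is `N₀` with
`|∑_{n<N, n % Q = a} μ(n)| ≤ ε N` for all `N ≥ N₀` and all `a`.  This is the input "periodic
sequences are orthogonal to `μ`" of Konieczny 2020, §2. [cite: MontgomeryVaughan2007, §11.3 Exercise 13(f) p. 384] -/
theorem moebius_residue_sum_le (Q : ℕ) (hQ : 0 < Q) {ε : ℝ} (hε : 0 < ε) :
    ∃ N₀ : ℕ, ∀ N : ℕ, N₀ ≤ N → ∀ a : ℕ,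
      |∑ n ∈ (range N).filter (fun n => n % Q = a), (μ n : ℝ)| ≤ ε * N := by
  obtain ⟨c, hc, C, hC⟩ := moebius_residue_sum_le_exp
  -- eventually (in `N'`): `N' ≥ 2`, `Q ≤ log N'` and `(|C|+1) exp(-c√log N') ≤ ε`
  have hev : ∀ᶠ N' : ℕ in atTop, (2 : ℝ) ≤ N' ∧ (Q : ℝ) ≤ Real.log N' ∧
      (|C| + 1) * Real.exp (-c * Real.sqrt (Real.log N')) ≤ ε := by
    refine ((tendsto_natCast_atTop_atTop (R := ℝ)).eventually_ge_atTop 2).and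
      (((Real.tendsto_log_atTop.comp (tendsto_natCast_atTop_atTop (R := ℝ))).eventually_ge_atTop
        (Q : ℝ)).and ?_)
    have ht := (tendsto_exp_neg_sqrt_log hc).const_mul (|C| + 1)
    rw [mul_zero] at ht
    exact ht.eventually_le_const hε
  obtain ⟨N₁, hN₁⟩ := eventually_atTop.1 hev
  refine ⟨N₁ + 1, fun N hN a => ?_⟩
  obtain ⟨N', rfl⟩ : ∃ N', N = N' + 1 := ⟨N - 1, by omega⟩
  obtain ⟨h2, hlog, hexp⟩ := hN₁ N' (by omega)
  by_cases ha : a < Q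
  · have hmain := hC Q hQ N' h2 hlog a
    rw [Nat.mod_eq_of_lt ha] at hmain
    refine hmain.trans ?_
    have hN'0 : (0 : ℝ) ≤ N' := by positivity
    have hE0 : 0 ≤ Real.exp (-c * Real.sqrt (Real.log N')) := (Real.exp_pos _).le
    calc C * N' * Real.exp (-c * Real.sqrt (Real.log N'))
        ≤ (|C| + 1) * N' * Real.exp (-c * Real.sqrt (Real.log N')) := by
          gcongr
          exact (le_abs_self C).trans (by linarith)
      _ = ((|C| + 1) * Real.exp (-c * Real.sqrt (Real.log N'))) * N' := by ring
      _ ≤ ε * N' := by gcongr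
      _ ≤ ε * ((N' + 1 : ℕ) : ℝ) :=
          mul_le_mul_of_nonneg_left (by exact_mod_cast Nat.le_succ N') hε.le
  · have hempty : (range (N' + 1)).filter (fun n => n % Q = a) = ∅ := by
      refine Finset.filter_eq_empty_iff.2 fun n _ h => ha ?_
      rw [← h]; exact Nat.mod_lt n hQ
    rw [hempty, Finset.sum_empty, abs_zero]
    positivity

/-! ## Periodic sequences -/

/-- **Bounded periodic sequences are orthogonal to `μ`, uniformly**: for `Q ≥ 1` and `ε > 0`
there is `N₀` such that `‖∑_{n<N} g(n) μ(n)‖ ≤ ε N` for every `N ≥ N₀` and EVERY `Q`-periodic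
`g` with `‖g‖ ≤ 1` (the threshold depends only on `Q`, `ε`).  Used in the proof of
Konieczny 2020, Lemma 2.3. [cite: Konieczny2020, Lemma 2.3] -/
theorem periodic_sum_mul_moebius_le (Q : ℕ) (hQ : 0 < Q) {ε : ℝ} (hε : 0 < ε) :
    ∃ N₀ : ℕ, ∀ N : ℕ, N₀ ≤ N → ∀ g : ℕ → ℂ, Function.Periodic g Q → (∀ n, ‖g n‖ ≤ 1) →
      ‖∑ n ∈ range N, g n * (μ n : ℂ)‖ ≤ ε * N := by
  have hεQ : 0 < ε / Q := div_pos hε (by exact_mod_cast hQ)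
  obtain ⟨N₀, hN₀⟩ := moebius_residue_sum_le Q hQ hεQ
  refine ⟨N₀, fun N hN g hg hg1 => ?_⟩
  have hfib : ∑ n ∈ range N, g n * (μ n : ℂ) =
      ∑ a ∈ range Q, ∑ n ∈ (range N).filter (fun n => n % Q = a), g n * (μ n : ℂ) :=
    (Finset.sum_fiberwise_of_maps_to (fun n _ => Finset.mem_range.2 (Nat.mod_lt n hQ)) _).symm
  have hinner : ∀ a ∈ range Q, ∑ n ∈ (range N).filter (fun n => n % Q = a), g n * (μ n : ℂ) =
      g a * ((∑ n ∈ (range N).filter (fun n => n % Q = a), (μ n : ℝ) : ℝ) : ℂ) := by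
    intro a _
    rw [Complex.ofReal_sum, Finset.mul_sum]
    refine Finset.sum_congr rfl fun n hn => ?_
    rw [Finset.mem_filter] at hn
    rw [Complex.ofReal_intCast, ← hn.2, hg.map_mod_nat]
  rw [hfib, Finset.sum_congr rfl hinner]
  calc ‖∑ a ∈ range Q, g a * ((∑ n ∈ (range N).filter (fun n => n % Q = a), (μ n : ℝ) : ℝ) : ℂ)‖
      ≤ ∑ a ∈ range Q, ‖g a * ((∑ n ∈ (range N).filter (fun n => n % Q = a), (μ n : ℝ) : ℝ) : ℂ)‖ :=
        norm_sum_le _ _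
    _ ≤ ∑ a ∈ range Q, ε / Q * N := by
        refine Finset.sum_le_sum fun a _ => ?_
        rw [norm_mul, Complex.norm_real, Real.norm_eq_abs]
        calc ‖g a‖ * |∑ n ∈ (range N).filter (fun n => n % Q = a), (μ n : ℝ)|
            ≤ 1 * (ε / Q * N) :=
              mul_le_mul (hg1 a) (hN₀ N hN a) (abs_nonneg _) zero_le_one
          _ = ε / Q * N := one_mul _
    _ = ε * N := by
        rw [Finset.sum_const, Finset.card_range, nsmul_eq_mul]
        field_simp

/-! ## Almost periodic sequences (Definition 2.2) and Lemma 2.3 -/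

/-- **Almost periodic sequences** (Konieczny 2020, Definition 2.2): `f : ℕ → ℂ` is almost
periodic if for every `ε > 0` there is a period `Q ≥ 1` such that for every `N` there is a
`Q`-periodic `g` (allowed to depend on `N`) with `‖f n - g n‖ ≤ ε` for all but at most `ε N`
values `n < N`.  Rendering notes: (i) we require the approximants to be `1`-bounded,
`‖g n‖ ≤ 1` — for `1`-bounded `f` this is no loss (the proof of Lemma 2.3 in the paper makes
exactly this reduction, replacing `g` by `g / max(1, |g|)` at the cost of `ε ↦ 2ε`), and all
approximants constructed in the paper (Proposition 5.4) are unimodular; (ii) "`ε`-almost all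
`n ∈ [N]`" is `#{n < N : ε < ‖f n - g n‖} ≤ ε N`. [cite: Konieczny2020, Definition 2.2] -/
def IsAlmostPeriodic (f : ℕ → ℂ) : Prop :=
  ∀ ε : ℝ, 0 < ε → ∃ Q : ℕ, 0 < Q ∧ ∀ N : ℕ, ∃ g : ℕ → ℂ, Function.Periodic g Q ∧
    (∀ n, ‖g n‖ ≤ 1) ∧ (((range N).filter (fun n => ε < ‖f n - g n‖)).card : ℝ) ≤ ε * N

/-- Pointwise bound used in Lemma 2.3: if `‖f n‖, ‖g n‖ ≤ 1` then
`‖f n - g n‖ ≤ ε + (if ε < ‖f n - g n‖ then 2 else 0)`. [folklore] -/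
theorem norm_sub_le_eps_add_ite {f g : ℕ → ℂ} {n : ℕ} (hf : ‖f n‖ ≤ 1) (hg : ‖g n‖ ≤ 1)
    (ε : ℝ) (hε : 0 ≤ ε) :
    ‖f n - g n‖ ≤ ε + (if ε < ‖f n - g n‖ then (2 : ℝ) else 0) := by
  split_ifs with h
  · calc ‖f n - g n‖ ≤ ‖f n‖ + ‖g n‖ := norm_sub_le _ _
      _ ≤ 1 + 1 := add_le_add hf hg
      _ ≤ ε + 2 := by linarith
  · have h' := not_lt.1 h
    linarith

/-- **Konieczny 2020, Lemma 2.3**: an almost periodic `1`-bounded sequence `f` is orthogonal to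
the Möbius function, `𝔼_{n<N} f(n) μ(n) → 0`.  Proof as printed: approximate `f` on `[N]` by a
`Q(ε)`-periodic `1`-bounded `g_N` off an `ε`-small set and use orthogonality of periodic
sequences uniformly in `g_N` (`periodic_sum_mul_moebius_le`). [cite: Konieczny2020, Lemma 2.3] -/
theorem IsAlmostPeriodic.tendsto_moebius {f : ℕ → ℂ} (hf : IsAlmostPeriodic f)
    (hb : ∀ n, ‖f n‖ ≤ 1) :
    Tendsto (fun N : ℕ => (N : ℂ)⁻¹ * ∑ n ∈ range N, f n * (μ n : ℂ)) atTop (𝓝 0) := by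
  rw [Metric.tendsto_atTop]
  intro ε' hε'
  set ε : ℝ := ε' / 8 with hεdef
  have hε : 0 < ε := by positivity
  obtain ⟨Q, hQ, hg⟩ := hf ε hε
  obtain ⟨N₀, hN₀⟩ := periodic_sum_mul_moebius_le Q hQ hε
  refine ⟨max N₀ 1, fun N hN => ?_⟩
  have hNN₀ : N₀ ≤ N := le_of_max_le_left hN
  have hN1 : 1 ≤ N := le_of_max_le_right hN
  have hNpos : (0 : ℝ) < N := by exact_mod_cast hN1
  obtain ⟨g, hgper, hg1, hcard⟩ := hg N
  -- split `f = (f - g) + g`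
  have hsplit : ∑ n ∈ range N, f n * (μ n : ℂ) =
      ∑ n ∈ range N, (f n - g n) * (μ n : ℂ) + ∑ n ∈ range N, g n * (μ n : ℂ) := by
    rw [← Finset.sum_add_distrib]
    refine Finset.sum_congr rfl fun n _ => by ring
  have h1 : ‖∑ n ∈ range N, (f n - g n) * (μ n : ℂ)‖ ≤ 3 * ε * N := by
    calc ‖∑ n ∈ range N, (f n - g n) * (μ n : ℂ)‖
        ≤ ∑ n ∈ range N, ‖(f n - g n) * (μ n : ℂ)‖ := norm_sum_le _ _
      _ ≤ ∑ n ∈ range N, (ε + (if ε < ‖f n - g n‖ then (2 : ℝ) else 0)) := by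
          refine Finset.sum_le_sum fun n _ => ?_
          rw [norm_mul]
          have hμ : ‖(μ n : ℂ)‖ ≤ 1 := by
            rw [Complex.norm_intCast]
            exact_mod_cast ArithmeticFunction.abs_moebius_le_one
          calc ‖f n - g n‖ * ‖(μ n : ℂ)‖ ≤ ‖f n - g n‖ * 1 :=
                mul_le_mul_of_nonneg_left hμ (norm_nonneg _)
            _ = ‖f n - g n‖ := mul_one _
            _ ≤ _ := norm_sub_le_eps_add_ite (hb n) (hg1 n) ε hε.le
      _ = ε * N + 2 * (((range N).filter (fun n => ε < ‖f n - g n‖)).card : ℝ) := by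
          rw [Finset.sum_add_distrib, Finset.sum_const, Finset.card_range, nsmul_eq_mul,
            ← Finset.sum_filter, Finset.sum_const, nsmul_eq_mul]
          ring
      _ ≤ ε * N + 2 * (ε * N) := by gcongr
      _ = 3 * ε * N := by ring
  have h2 : ‖∑ n ∈ range N, g n * (μ n : ℂ)‖ ≤ ε * N := hN₀ N hNN₀ g hgper hg1
  have htot : ‖∑ n ∈ range N, f n * (μ n : ℂ)‖ ≤ 4 * ε * N := by
    rw [hsplit]
    refine (norm_add_le _ _).trans ?_
    linarith
  rw [dist_zero_right, norm_mul, norm_inv, Complex.norm_natCast]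
  calc (N : ℝ)⁻¹ * ‖∑ n ∈ range N, f n * (μ n : ℂ)‖ ≤ (N : ℝ)⁻¹ * (4 * ε * N) := by gcongr
    _ = 4 * ε := by field_simp
    _ < ε' := by rw [hεdef]; linarith

/-- **Lemma 2.5, the instance used in §8**: the product of an almost periodic sequence with a
`1`-bounded periodic sequence is almost periodic. [cite: Konieczny2020, Lemma 2.5] -/
theorem IsAlmostPeriodic.mul_periodic {f u : ℕ → ℂ} (hf : IsAlmostPeriodic f) {b : ℕ}
    (hb : 0 < b) (hu : Function.Periodic u b) (hu1 : ∀ n, ‖u n‖ ≤ 1) :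
    IsAlmostPeriodic (fun n => f n * u n) := by
  intro ε hε
  obtain ⟨Q, hQ, hg⟩ := hf ε hε
  refine ⟨Q * b, Nat.mul_pos hQ hb, fun N => ?_⟩
  obtain ⟨g, hgper, hg1, hcard⟩ := hg N
  refine ⟨fun n => g n * u n, ?_, fun n => ?_, ?_⟩
  · have hgQ : Function.Periodic g (Q * b) := by simpa [mul_comm] using hgper.nat_mul b
    have huQ : Function.Periodic u (Q * b) := by simpa using hu.nat_mul Q
    intro n
    show g (n + Q * b) * u (n + Q * b) = g n * u n
    rw [hgQ n, huQ n]
  · rw [norm_mul]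
    calc ‖g n‖ * ‖u n‖ ≤ 1 * 1 := mul_le_mul (hg1 n) (hu1 n) (norm_nonneg _) zero_le_one
      _ = 1 := one_mul _
  · refine le_trans ?_ hcard
    gcongr with n
    show ‖f n * u n - g n * u n‖ ≤ ‖f n - g n‖
    rw [← sub_mul, norm_mul]
    calc ‖f n - g n‖ * ‖u n‖ ≤ ‖f n - g n‖ * 1 :=
        mul_le_mul_of_nonneg_left (hu1 n) (norm_nonneg _)
      _ = ‖f n - g n‖ := mul_one _

end Konieczny

end Literature.NumberTheory.LFunctions
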